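import Mathlib
import Summits.NavierStokesRegularity.NavierStokesRegularity.Theorems.FilamentSkeletonRssKelvinGateSharpGateOpen
import Summits.NavierStokesRegularity.NavierStokesRegularity.Theorems.FilamentSkeletonRssKelvinGateClosingAlgebra

/-!
# Route `FilamentSkeletonRss` · crux `TransverseReduction1A` (stmt-27414; successor of the aside `TransverseReductionRJ`,
# stmt-21221) — line `kelvin_gate`: the SHARP GATE SPECIFICATION `SharpGateSpec`; free instance, openness, and S2′ ⇒ S3′

Definition + theorems (`--as helper`; `SharpGateSpec` is route-posited vocabulary like `GateSpec` of `…KelvinGateDefs`).  HONEST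
FRAMING: analysis bookkeeping for a HYPOTHETICAL filament-type rotating self-similar blow-up route; nothing here bears on
Navier–Stokes regularity; no stub is proved here; `TransverseReduction1A` is neither proved nor refuted.

`SharpGateSpec a A α U⁰ K 𝒬` says: `(K, 𝒬)` is a KELVIN GATE at the base `U⁰` and rate `α` in the sharp scales with bound `A` —
for every `F ∈ Y♯_a(R)`: `K F ∈ X♯_a(AR)` is divergence free, `𝒬 F ∈ C¹` with `|𝒬 F| ≤ AR`, and
`𝓛_(α,U⁰)(K F) + ∇(𝒬 F) = F`; and `K` is linear on sharp-Y-bounded data.  (No accretion modes, no multipliers: the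
re-typed crux `TransverseReduction1A` has none; the rate is a separate unknown.)

* `sharpGateSpec_free` — **the free gate is a sharp gate at `U⁰ = 0` for EVERY `α`** with one bound `C(a)` (`free_kelvin_gate_ySharp`);
* `SharpGateSpec.perturb` — **openness**: a sharp gate at `U⁰` with bound `A` and a `C²` increment `V` of size `M`, `8AM ≤ 1`, give a
  sharp gate at `U⁰ + V` with bound `2A` (`sharp_gate_open` + `lerayLin_add_base`);
* `SharpGateSpec.closing` — **S2′ ⇒ S3′ in the sharp scales**: a sharp gate at `(α, U⁰)` (`U⁰ ∈ C²`, `P⁰` differentiable) and a base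
  residual `E_α(U⁰) + ∇P⁰ = −r` with `Y♯_a(r) ≤ ε`, `16A²ε ≤ 1` give `W ∈ X♯_a(2Aε)` (div-free) and `Q ∈ C¹` (`|Q| ≤ 2Aε`) with the
  EXACT profile equation `E_α(U⁰ + W) + ∇(P⁰ + Q) = 0` pointwise (`sharp_picard_exists_fixedPoint` + `profileEquation`-algebra).
So, in these scales, the line's S3′ is a THEOREM given S2′; the crux is S1′ (dressing) + S2′ at the dressed `O(Γ)` base (+ the rate).
-/

set_option linter.dupNamespace false

noncomputable section

namespace Summit.NavierStokesRegularity.NavierStokesRegularity.Theorems.KelvinGate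

open Set Function Filter MeasureTheory
open Literature.Analysis.FluidPDE Literature.Analysis.FluidPDE.NewtonPotentialHolder Literature.Analysis.UnboundedOperators
open scoped InnerProductSpace Laplacian ContDiff Topology BigOperators

/-- **Sharp Kelvin gate specification** at base `U⁰`, rate `α`, internal weight `a`, bound `A`: `(K, 𝒬)` is a bounded LINEAR
right inverse of `W ↦ 𝓛_(α,U⁰) W + ∇·` from `Y♯_a` to `X♯_a × C¹`, with divergence-free velocity and bounded pressure. -/
def SharpGateSpec (a A α : ℝ) (U0 : EuclideanSpace ℝ (Fin 3) → EuclideanSpace ℝ (Fin 3))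
    (K : (EuclideanSpace ℝ (Fin 3) → EuclideanSpace ℝ (Fin 3)) → EuclideanSpace ℝ (Fin 3) → EuclideanSpace ℝ (Fin 3))
    (𝒬 : (EuclideanSpace ℝ (Fin 3) → EuclideanSpace ℝ (Fin 3)) → EuclideanSpace ℝ (Fin 3) → ℝ) : Prop :=
  (∀ (F : EuclideanSpace ℝ (Fin 3) → EuclideanSpace ℝ (Fin 3)) (R : ℝ), YSharp a F R →
      XSharp a (K F) (A * R) ∧ VectorCalculus.IsDivFree (K F) ∧ ContDiff ℝ 1 (𝒬 F) ∧ (∀ y, |𝒬 F y| ≤ A * R) ∧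
        ∀ y, lerayLin α U0 (K F) y + gradient (𝒬 F) y = F y) ∧
  (∀ (F G : EuclideanSpace ℝ (Fin 3) → EuclideanSpace ℝ (Fin 3)) (s : ℝ), (∃ R, YSharp a F R) → (∃ R, YSharp a G R) →
      K (fun y => F y + s • G y) = fun y => K F y + s • K G y)

/-! ## The free gate is a sharp gate at the trivial base, for every rate -/

/-- **The free gate satisfies `SharpGateSpec` at `U⁰ = 0`** with one constant `C(a)` for all rates `α` (`1 < a < 2`). -/
theorem sharpGateSpec_free {a : ℝ} (ha1 : 1 < a) (ha2 : a < 2) :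
    ∃ C : ℝ, 0 ≤ C ∧ ∀ α : ℝ, SharpGateSpec a C α (fun _ => 0)
      (fun F y => ∫ s in Ioi (0:ℝ), (Real.exp (-(s / 2)) • rotZL (-(α * s)))
        (heatExtension (fun x => F x - gradient (fun x => ∑ j : Fin 3,
          newtonGradPotential (EuclideanSpace.single j (1:ℝ)) (fun y => F y j) x) x)
          (1 - Real.exp (-s)) ((Real.exp (-(s / 2)) • rotZL (α * s)) y)))
      (fun F x => ∑ j : Fin 3, newtonGradPotential (EuclideanSpace.single j (1:ℝ)) (fun y => F y j) x) := by
  obtain ⟨C, hC0, h⟩ := free_kelvin_gate_ySharp ha1 ha2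
  refine ⟨C, hC0, fun α => ⟨fun F R hF => ?_, fun F G s hF hG => ?_⟩⟩
  · obtain ⟨hX, hdiv, hQ1, hQb, -, heq⟩ := h α F R hF
    exact ⟨hX, hdiv, hQ1, hQb, heq⟩
  · obtain ⟨R, hFR⟩ := hF
    obtain ⟨R', hGR⟩ := hG
    funext y
    exact sharpGate_add_smul ha1.le hFR hGR s α y

/-! ## Openness: a sharp gate survives a small change of base -/

/-- **`SharpGateSpec` is open in the base**: a sharp gate at `U⁰` (differentiable) with bound `A` and a `C²` increment `V` with
`⟨y⟩‖V‖, ⟨y⟩²‖DV‖, ⟨y⟩³‖D²V‖ ≤ M`, `8AM ≤ 1`, yield a sharp gate at `U⁰ + V` with bound `2A` (`1 ≤ a ≤ 2`); the new pressure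
operator is `F ↦ 𝒬 (F − (D(K′F)[V] + DV[K′F]))` (the Neumann fixed point, explicit in terms of `K′`). -/
theorem SharpGateSpec.perturb {a A α M : ℝ} {U0 V : EuclideanSpace ℝ (Fin 3) → EuclideanSpace ℝ (Fin 3)}
    {K : (EuclideanSpace ℝ (Fin 3) → EuclideanSpace ℝ (Fin 3)) → EuclideanSpace ℝ (Fin 3) → EuclideanSpace ℝ (Fin 3)}
    {𝒬 : (EuclideanSpace ℝ (Fin 3) → EuclideanSpace ℝ (Fin 3)) → EuclideanSpace ℝ (Fin 3) → ℝ}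
    (hg : SharpGateSpec a A α U0 K 𝒬) (ha1 : 1 ≤ a) (ha2 : a ≤ 2) (hU0 : Differentiable ℝ U0)
    (hV : ContDiff ℝ 2 V) (hV0 : ∀ y, (1 + ‖y‖) * ‖V y‖ ≤ M)
    (hV1 : ∀ y, (1 + ‖y‖) ^ 2 * ‖fderiv ℝ V y‖ ≤ M) (hV2 : ∀ y, (1 + ‖y‖) ^ 3 * ‖fderiv ℝ (fderiv ℝ V) y‖ ≤ M)
    (hAM : 8 * A * M ≤ 1) :
    ∃ (K' : (EuclideanSpace ℝ (Fin 3) → EuclideanSpace ℝ (Fin 3)) → EuclideanSpace ℝ (Fin 3) → EuclideanSpace ℝ (Fin 3)),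
      SharpGateSpec a (2 * A) α (fun z => U0 z + V z) K'
        (fun F => 𝒬 (fun y => F y - (fderiv ℝ (K' F) y (V y) + fderiv ℝ V y (K' F y)))) := by
  obtain ⟨K', hK'1, hK'2, hK'3⟩ := sharp_gate_open (K := K) (A := A) ha1 ha2 (fun F R hF => (hg.1 F R hF).1) hg.2 hV hV0 hV1 hV2 hAM
  refine ⟨K', fun F R hF => ?_, hK'2⟩
  obtain ⟨G, hG, hKG, hGeq⟩ := hK'3 F R hF
  -- the fixed point is explicit: `G = F − (D(K′F)[V] + DV[K′F])`
  have hGfun : (fun y => F y - (fderiv ℝ (K' F) y (V y) + fderiv ℝ V y (K' F y))) = G := by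
    funext y; rw [← hGeq y]; abel
  simp only [hGfun]
  obtain ⟨hXG, hdivG, hQ1, hQb, heqG⟩ := hg.1 G (2 * R) hG
  refine ⟨hK'1 F R hF, by rw [hKG]; exact hdivG, hQ1, fun y => (hQb y).trans (le_of_eq (by ring)), fun y => ?_⟩
  have hVd : DifferentiableAt ℝ V y := (hV.differentiable (by norm_num)) y
  rw [lerayLin_add_base α U0 V (K' F) y (hU0 y) hVd, hKG, add_right_comm, heqG y, ← hKG]
  exact hGeq y

/-! ## S2′ ⇒ S3′: the nonlinear closing from a sharp gate -/

/-- **NONLINEAR CLOSING FROM A SHARP GATE (S2′ ⇒ S3′ in the sharp scales).**  Let `(K, 𝒬)` be a sharp gate at `(α, U⁰)` with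
bound `A` (`1 ≤ a`), `U⁰ ∈ C²`, `P⁰` differentiable, and let the base residual `r := E_α(U⁰) + ∇P⁰` satisfy `YSharp a r ε` with
`16 A² ε ≤ 1`.  Then there are `W ∈ X♯_a(2Aε)`, divergence free, and `Q ∈ C¹` with `|Q| ≤ 2Aε` such that `U⁰ + W`, `P⁰ + Q` solve
the rotating Leray profile equation EXACTLY: `E_α(U⁰ + W) + ∇(P⁰ + Q) = 0` pointwise. -/
theorem SharpGateSpec.closing {a A α ε : ℝ} {U0 : EuclideanSpace ℝ (Fin 3) → EuclideanSpace ℝ (Fin 3)}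
    {K : (EuclideanSpace ℝ (Fin 3) → EuclideanSpace ℝ (Fin 3)) → EuclideanSpace ℝ (Fin 3) → EuclideanSpace ℝ (Fin 3)}
    {𝒬 : (EuclideanSpace ℝ (Fin 3) → EuclideanSpace ℝ (Fin 3)) → EuclideanSpace ℝ (Fin 3) → ℝ}
    (hg : SharpGateSpec a A α U0 K 𝒬) (ha1 : 1 ≤ a) (hU0 : ContDiff ℝ 2 U0)
    {P0 : EuclideanSpace ℝ (Fin 3) → ℝ} (hP0 : Differentiable ℝ P0)
    {r : EuclideanSpace ℝ (Fin 3) → EuclideanSpace ℝ (Fin 3)} (hres : ∀ y, lerayOp α U0 y + gradient P0 y = r y)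
    (hr : YSharp a r ε) (hA : 16 * A ^ 2 * ε ≤ 1) :
    ∃ (W : EuclideanSpace ℝ (Fin 3) → EuclideanSpace ℝ (Fin 3)) (Q : EuclideanSpace ℝ (Fin 3) → ℝ),
      XSharp a W (2 * A * ε) ∧ VectorCalculus.IsDivFree W ∧ ContDiff ℝ 1 Q ∧ (∀ y, |Q y| ≤ 2 * A * ε) ∧
      ∀ y, lerayOp α (fun z => U0 z + W z) y + gradient (fun z => P0 z + Q z) y = 0 := by
  obtain ⟨F, hF, hfix⟩ := sharp_picard_exists_fixedPoint (K := K) (A := A) ha1 (fun F R hF => (hg.1 F R hF).1) hg.2 hr hA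
  obtain ⟨hX, hdiv, hQ1, hQb, heq⟩ := hg.1 F (2 * ε) hF
  refine ⟨K F, 𝒬 F, hX.mono (le_of_eq (by ring)), hdiv, hQ1, fun y => (hQb y).trans (le_of_eq (by ring)), fun y => ?_⟩
  have hW2 : ContDiffAt ℝ 2 (K F) y := hX.1.contDiffAt
  have hQd : DifferentiableAt ℝ (𝒬 F) y := (hQ1.differentiable (by norm_num)) y
  rw [lerayOp_add_eq α U0 (K F) y hU0.contDiffAt hW2, gradient_fun_add' (hP0 y) hQd]
  have e : lerayOp α U0 y + lerayLin α U0 (K F) y + fderiv ℝ (K F) y (K F y) + (gradient P0 y + gradient (𝒬 F) y) =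
      (lerayOp α U0 y + gradient P0 y) + (lerayLin α U0 (K F) y + gradient (𝒬 F) y) + fderiv ℝ (K F) y (K F y) := by abel
  rw [e, hres y, heq y, hfix y]
  abel

end Summit.NavierStokesRegularity.NavierStokesRegularity.Theorems.KelvinGate

end
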